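import Summits.QuantumFields.BalabanUV.Beta.GAN24.CouplingCurveTaylor

/-!
# `BalabanUV.Beta.GAN24.ResolventCurveJetLocality` — binder row G-an2-4 ∕ (CONV-C), route R7 «TWO CURRENCIES», PART 244: JET LOCALITY — the `N`-th derivative at `s = 0` of the
# inverse of a resolvent read-out along a real curve `s ↦ D + P(s)` depends ONLY on the jets `P(0), P′(0), …, P^{(N)}(0)`: two jet towers that agree at `s = 0` up to order `N` give the
# same `∂^N_s[(Φ(D + P(s))⁻¹)⁻¹]|₀` (PART 240's uniform Faà di Bruno WITH ITS LETTER BOUND `≤ N`).  Hence (§2) two curves of coupling letters whose background jets agree at `s = 0` up to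
# order `N` have IDENTICAL order-`N` tower families — e.g. the exponential chart `U_s = exp(isηA)` of a connection and its degree-`N` Taylor polynomial chart, or ANY two transporter
# curves with the same `N`-jet at `U = 1`: the β-cell END of one is the END of the other, with nothing to re-prove (unit b2b-balaban-gan24-p3, gen 65; v1)

NOT IN PRINT; OUR PROOF ([folklore] bookkeeping BY NAME over PART 240 (`iteratedDeriv_inv_eq_curveDiagramSum`), PART 241 (`hasDerivAt_couplingLetter_curve`), Mathlib's `List.foldr_ext`,
`List.map_congr_left`; nothing printed is a hypothesis).
HONEST FRAMING (cell contract, verbatim): «discharging `BetaPertH` makes Bałaban's UV stability UNCONDITIONAL — a real constructive-QFT result; it is NOT the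
continuum limit and NOT the Clay problem.»  HONEST DEPENDENCY (verbatim): «continuum YM on T⁴ ⇐ BetaPertH ∧ nine spine estimates (0/9 proved); BetaPertH ⇐
(D1) ∧ (D4) ∧ CAP+tail; G-an2-4 gates asym, D1 and NE2/3/4.»

WHAT THIS FILE PROVES (0 sorry, 0 `def`):
* §1 (GENERIC) **`iteratedDeriv_inv_curve_eq_of_jets`**: jet towers `Pd, Pd′` (`∂_sP_j = P_{j+1}`) with `P_j(0) = P′_j(0)` for `j ≤ N`, `D + P(0)` and `Φ(R(0))` invertible ⟹
  `∂^N_s[(Φ(D + P(s))⁻¹)⁻¹]|₀ = ∂^N_s[(Φ(D + P′(s))⁻¹)⁻¹]|₀`.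
* §2 **`iteratedDeriv_invPertCov_couplingCurve_eq_of_jets`**: two curves of coupling letters on a torus (entrywise jet towers `(V, Z)`, `(V′, Z′)`) with `V^{(j)}(0) = V′^{(j)}(0)`,
  `Z^{(j)}(0) = Z′^{(j)}(0)` for `j ≤ N` and `V^{(0)}(0) = 0`, `Z^{(0)}(0) = 0` give the same `∂^N_s[(c_k(s))⁻¹]|₀` at every level `k` — so PART 241 ∕ 242 ∕ 243's ENDs transfer verbatim
  between curves with equal `N`-jets at `U = 1`.
WHAT IT DOES NOT DO: compute the jets of any particular chart (PART 243: the linear chart; the exponential chart's `w^{(j)}(0) = η^{j−1}·(iA)^j` is a follower).  SUPPLIER work; NEVER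
«G-an2-4 closed»; NOT (CONV-C), NOT D1, NOT `BetaPertH`, NOT continuum, NOT Clay.  Records: `HOME/b2b-balaban-gan24-p3/gen65/README.md`.
-/

noncomputable section

open scoped BigOperators ComplexConjugate Matrix Matrix.Norms.L2Operator
open Filter Topology

namespace Summit.QuantumFields.BalabanUV.Beta.GAN24.ResolventCurveJetLocality

open Literature.MathematicalPhysics.QuantumFieldTheory.Balaban1983to89
open Literature.MathematicalPhysics.QuantumFieldTheory.Balaban1983to89.B5G183RateUnitTower (lev)
open Summit.QuantumFields.BalabanUV.T4Continuum
open Summit.QuantumFields.BalabanUV.T4Continuum.CovariantAveragingTower (avgTow)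
open Summit.QuantumFields.BalabanUV.T4Continuum.BalabanAveragedTowerUnit (idx QBlev calGlev unitCovB)
open Summit.QuantumFields.BalabanUV.T4Continuum.KingPairingPlantedLaw (calDalev calDalev_inv isUnit_det_calDalev)
open Summit.QuantumFields.BalabanUV.T4Continuum.FirstOrderBackgroundModel (LipschitzBackground Pmodel)
open Summit.QuantumFields.BalabanUV.Beta.GAN24.EffectiveFormInsertionLaw (isUnit_det_unitCovB_and_opNorm_inv_le)
open Summit.QuantumFields.BalabanUV.Beta.GAN24.BackgroundExpansionTaylor (exists_clm_avgTow)
open Summit.QuantumFields.BalabanUV.Beta.GAN24.ResolventCurveTaylor (iteratedDeriv_inv_eq_curveDiagramSum)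
open Summit.QuantumFields.BalabanUV.Beta.GAN24.CouplingCurveTaylor (hasDerivAt_couplingLetter_curve Pmodel_zero)

/-! ## §1 Generic jet locality -/

section Generic

variable {m n : Type} [Fintype m] [DecidableEq m] [Fintype n] [DecidableEq n]

/-- **`iteratedDeriv_inv_curve_eq_of_jets` — JET LOCALITY** [our proof]: for two jet towers `Pd, Pd′` along real curves of complex matrices (`∂_sP_j = P_{j+1}`, `∂_sP′_j = P′_{j+1}`) that
AGREE AT `s = 0` UP TO ORDER `N`, with `D + P(0)` and `Φ((D + P(0))⁻¹)` invertible, the `N`-th derivatives at `0` of `(Φ(D + P(s))⁻¹)⁻¹` and `(Φ(D + P′(s))⁻¹)⁻¹` coincide — both equal PART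
240's diagram sum, whose letters read only `P_j(0)`, `1 ≤ j ≤ N`, and `P_0(0)`. -/
theorem iteratedDeriv_inv_curve_eq_of_jets (N : ℕ) (D : Matrix m m ℂ) (Pd Pd' : ℕ → ℝ → Matrix m m ℂ) (Φ : Matrix m m ℂ →L[ℂ] Matrix n n ℂ)
    (hPd : ∀ j v, HasDerivAt (Pd j) (Pd (j + 1) v) v) (hPd' : ∀ j v, HasDerivAt (Pd' j) (Pd' (j + 1) v) v)
    (hj : ∀ j, j ≤ N → Pd j 0 = Pd' j 0) (h0 : IsUnit (D + Pd 0 0).det) (hc : IsUnit (Φ (D + Pd 0 0)⁻¹).det) :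
    iteratedDeriv N (fun v : ℝ => (Φ (D + Pd 0 v)⁻¹)⁻¹) 0 = iteratedDeriv N (fun v : ℝ => (Φ (D + Pd' 0 v)⁻¹)⁻¹) 0 := by
  obtain ⟨J, hJ, z, ℓ, hℓ, hN⟩ := iteratedDeriv_inv_eq_curveDiagramSum N
  have h00 : Pd 0 0 = Pd' 0 0 := hj 0 (Nat.zero_le N)
  have h0' : IsUnit (D + Pd' 0 0).det := by rw [← h00]; exact h0
  have hc' : IsUnit (Φ (D + Pd' 0 0)⁻¹).det := by rw [← h00]; exact hc
  rw [hN D Pd Φ 0 hPd h0 hc, hN D Pd' Φ 0 hPd' h0' hc']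
  refine Finset.sum_congr rfl fun i _ => ?_
  congr 1
  refine congrArg List.prod (List.map_congr_left fun o ho => ?_)
  cases o with
  | none => simp only [Option.elim, h00]
  | some w =>
    simp only [Option.elim]
    rw [h00]
    refine congrArg Φ (List.foldr_ext _ _ _ fun j hjw Nm => ?_)
    rw [hj j (hℓ i w ho j hjw).2]

end Generic

/-! ## §2 Curves of coupling letters with the same jets at `s = 0` -/

section Coupling

variable {d : ℕ} (L : ℕ) [NeZero L] (M : Fin d → ℕ) [hM : ∀ μ, NeZero (M μ)] (a : ℝ) (ha : 0 < a)

/-- **`iteratedDeriv_invPertCov_couplingCurve_eq_of_jets`** [our proof]: on a torus `M`, two curves of coupling letters `A(s) = P(V^{(0)}(s)) + P(V^{(0)}(s))ᴴ + diag Z^{(0)}(s)` and `A′(s)`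
(entrywise jet towers `(V, Z)`, `(V′, Z′)`, both through the free operator: `V^{(0)}(0) = 0`, `Z^{(0)}(0) = 0`) whose jets agree at `s = 0` up to order `N` give the SAME
`∂^N_s[(L^{dk}Q_k(Δ_a^{(k)} + A_k(s))⁻¹Q_kᴴ)⁻¹]|_{s=0}` at every level `k` (§1 at `D = Δ_a^{(k)}`, `Φ = L^{dk}Q_k(·)Q_kᴴ`; PART 241 §1 lifts the entrywise towers). -/
theorem iteratedDeriv_invPertCov_couplingCurve_eq_of_jets (N : ℕ)
    {V V' : ℕ → ℝ → (k : ℕ) → Fin d → (idx L M k → ℂ)} {Z Z' : ℕ → ℝ → (k : ℕ) → (idx L M k → ℂ)}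
    (hVd : ∀ j s k μ x, HasDerivAt (fun v => V j v k μ x) (V (j + 1) s k μ x) s) (hZd : ∀ j s k x, HasDerivAt (fun v => Z j v k x) (Z (j + 1) s k x) s)
    (hVd' : ∀ j s k μ x, HasDerivAt (fun v => V' j v k μ x) (V' (j + 1) s k μ x) s) (hZd' : ∀ j s k x, HasDerivAt (fun v => Z' j v k x) (Z' (j + 1) s k x) s)
    (hV00 : V 0 0 = 0) (hZ00 : Z 0 0 = 0) (hVj : ∀ j, j ≤ N → V j 0 = V' j 0) (hZj : ∀ j, j ≤ N → Z j 0 = Z' j 0) (k : ℕ) :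
    iteratedDeriv N (fun s : ℝ => (avgTow (QBlev L M) ((L : ℝ) ^ d)
        (fun k' => (calDalev L M a ha k' + (Pmodel L M (V 0 s) k' + (Pmodel L M (V 0 s) k')ᴴ + Matrix.diagonal (Z 0 s k')))⁻¹) k)⁻¹) 0
      = iteratedDeriv N (fun s : ℝ => (avgTow (QBlev L M) ((L : ℝ) ^ d)
        (fun k' => (calDalev L M a ha k' + (Pmodel L M (V' 0 s) k' + (Pmodel L M (V' 0 s) k')ᴴ + Matrix.diagonal (Z' 0 s k')))⁻¹) k)⁻¹) 0 := by
  obtain ⟨Φ, hΦ⟩ := exists_clm_avgTow (QBlev L M) ((L : ℝ) ^ d) k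
  set D : Matrix (idx L M k) (idx L M k) ℂ := calDalev L M a ha k with hD
  set Pd : ℕ → ℝ → Matrix (idx L M k) (idx L M k) ℂ := fun j s => Pmodel L M (V j s) k + (Pmodel L M (V j s) k)ᴴ + Matrix.diagonal (Z j s k) with hPd
  set Pd' : ℕ → ℝ → Matrix (idx L M k) (idx L M k) ℂ := fun j s => Pmodel L M (V' j s) k + (Pmodel L M (V' j s) k)ᴴ + Matrix.diagonal (Z' j s k) with hPd'
  have hF : (fun s : ℝ => (avgTow (QBlev L M) ((L : ℝ) ^ d)
      (fun k' => (calDalev L M a ha k' + (Pmodel L M (V 0 s) k' + (Pmodel L M (V 0 s) k')ᴴ + Matrix.diagonal (Z 0 s k')))⁻¹) k)⁻¹) = fun s : ℝ => (Φ (D + Pd 0 s)⁻¹)⁻¹ := by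
    funext s; rw [hΦ]
  have hF' : (fun s : ℝ => (avgTow (QBlev L M) ((L : ℝ) ^ d)
      (fun k' => (calDalev L M a ha k' + (Pmodel L M (V' 0 s) k' + (Pmodel L M (V' 0 s) k')ᴴ + Matrix.diagonal (Z' 0 s k')))⁻¹) k)⁻¹) = fun s : ℝ => (Φ (D + Pd' 0 s)⁻¹)⁻¹ := by
    funext s; rw [hΦ]
  have hPdD : ∀ j v, HasDerivAt (Pd j) (Pd (j + 1) v) v := fun j v => hasDerivAt_couplingLetter_curve L M hVd hZd k j v
  have hPdD' : ∀ j v, HasDerivAt (Pd' j) (Pd' (j + 1) v) v := fun j v => hasDerivAt_couplingLetter_curve L M hVd' hZd' k j v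
  have hP00 : Pd 0 0 = 0 := by
    show Pmodel L M (V 0 0) k + (Pmodel L M (V 0 0) k)ᴴ + Matrix.diagonal (Z 0 0 k) = 0
    rw [hV00, hZ00, Pmodel_zero, Matrix.conjTranspose_zero, Pi.zero_apply, add_zero, zero_add]
    exact Matrix.diagonal_zero
  have ec : Φ D⁻¹ = unitCovB L M a ha k := by
    rw [hD, calDalev_inv]
    exact (hΦ (calGlev L M a ha)).symm
  have h0 : IsUnit (D + Pd 0 0).det := by rw [hP00, add_zero]; exact isUnit_det_calDalev L M a ha k
  have hc0 : IsUnit (Φ (D + Pd 0 0)⁻¹).det := by rw [hP00, add_zero, ec]; exact (isUnit_det_unitCovB_and_opNorm_inv_le L M a ha k).1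
  have hj : ∀ j, j ≤ N → Pd j 0 = Pd' j 0 := fun j hjN => by
    show Pmodel L M (V j 0) k + (Pmodel L M (V j 0) k)ᴴ + Matrix.diagonal (Z j 0 k) = Pmodel L M (V' j 0) k + (Pmodel L M (V' j 0) k)ᴴ + Matrix.diagonal (Z' j 0 k)
    rw [hVj j hjN, hZj j hjN]
  rw [hF, hF']
  exact iteratedDeriv_inv_curve_eq_of_jets N D Pd Pd' Φ hPdD hPdD' hj h0 hc0

end Coupling

end Summit.QuantumFields.BalabanUV.Beta.GAN24.ResolventCurveJetLocality

end
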